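import Summits.BirchSwinnertonDyer.Rank1Residual.FineSelmerGcdProblems
import Literature.NumberTheory.EllipticCurves.IwasawaAlgebraMuVanishingProofs
import HarnessLib

/-!
# Kernel edge of the leaf `FineSelmerGcdProblems`: «if (Gr) holds, then Conjecture A of [CS] holds»
# (Lei–Sujatha 2021, §1) — PROVED bookkeeping, nothing asserted (typing layer D-0088(4), cell
# `bsd-littype`, seat 11, gen 4)

Lei–Sujatha, Proc. AMS (2021), §1 (held TeX `paper:arxiv-2103.06150` p0003 L7, L22), verbatim:
"Conjecture A in [CS] further predicts that it [`Sel₀(E/ℚ_cyc)^∨`] should be a finitely generated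
`ℤ_p`-module, which is equivalent to saying that its `μ`-invariant is zero." … "In particular, if (Gr)
holds, then Conjecture A of [CS] holds as well." This file kernel-checks that sentence for the leaf
`GreenbergFineSelmerProblem` (p483901): the right-hand side of (Gr) is (the image in `Λ = ℤ_p⟦X⟧` of)
a MONIC polynomial `X^{e₀−1} · ∏ Φ_n(1+X)^{e_n−1}`, so it has a unit coefficient
(`exists_isUnit_coeff_grProduct`), and a finitely generated torsion `Λ`-module whose characteristic
ideal is generated by an element with a unit coefficient has `μ = 0` (tree theorem
`muInvariant_eq_zero_iff_exists_isUnit_coeff_of_charIdeal_eq_span`, Greenberg–Vatsal (1)–(2)). Hence,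
GRANTED (Gr) (displayed hypothesis `h`; OPEN), `μ(Sel₀(E/ℚ_cyc)^∨) = 0` for every dual datum that is
finitely generated and torsion (Kato; displayed, not re-asserted) at every pair where the printed
exponents `e_n` and a stationarity level exist (printed as always the case; displayed)
(`muInvariant_eq_zero_of_greenbergFineSelmerProblem`). THEOREMS ONLY; closes nothing; Coates–Sujatha's
Conjecture A itself is not filed here (its `μ = 0` form is the conclusion's shape). HONEST FRAMING
(cell): typed ≠ proved ≠ endorsed. References: [LeiSujatha2021] §1; [KuriharaPollack2007] §0.3, §3.1
(`μ(Sel₀(E/ℚ_∞)^∨) = 0` from `μ^{class}_{ℚ(E[p])} = 0`, Coates–Sujatha Thm. 3.4); [CoatesSujatha2005]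
Conj. A; [GreenbergVatsal2000] p. 2 (1)–(2).
-/

set_option autoImplicit false

noncomputable section

open scoped Classical

open Polynomial WeierstrassCurve Literature.NumberTheory.EllipticCurves

namespace Summit.BirchSwinnertonDyer.Rank1Residual.FineSelmer

/-- **The right-hand side of (Gr) has a unit coefficient**: `X^{a} · ∏_{1 ≤ n ≤ N} Φ_n(1+X)^{b_n}` is
the image in `Λ = ℤ_p⟦X⟧` of a monic polynomial (`X`, and each `Φ_{pⁿ}(X+1)`, are monic), whose
leading coefficient `1` is a unit. [folklore] -/
theorem exists_isUnit_coeff_grProduct (p : ℕ) [Fact p.Prime] (a : ℕ) (b : ℕ → ℕ) (N : ℕ) :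
    ∃ m : ℕ, IsUnit (PowerSeries.coeff m
      ((PowerSeries.X : IwasawaAlgebra p) ^ a *
        ∏ n ∈ Finset.Icc 1 N,
          ((((cyclotomic (p ^ n) ℤ).comp (X + 1)).map (Int.castRingHom ℤ_[p]) : ℤ_[p][X]) :
              PowerSeries ℤ_[p]) ^ b n)) := by
  set Q : ℤ_[p][X] := X ^ a *
    ∏ n ∈ Finset.Icc 1 N, (((cyclotomic (p ^ n) ℤ).comp (X + 1)).map (Int.castRingHom ℤ_[p])) ^ b n
    with hQ
  have hmonic : Q.Monic := by
    refine (monic_X_pow a).mul (monic_prod_of_monic _ _ fun n _ ↦ Monic.pow ?_ _)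
    have h1 : ((cyclotomic (p ^ n) ℤ).comp (X + 1)).Monic := by
      simpa using (cyclotomic.monic (p ^ n) ℤ).comp_X_add_C 1
    exact h1.map _
  have hcoe : ((PowerSeries.X : IwasawaAlgebra p) ^ a *
      ∏ n ∈ Finset.Icc 1 N,
        ((((cyclotomic (p ^ n) ℤ).comp (X + 1)).map (Int.castRingHom ℤ_[p]) : ℤ_[p][X]) :
            PowerSeries ℤ_[p]) ^ b n) = (Q : PowerSeries ℤ_[p]) := by
    rw [hQ, ← coeToPowerSeries.ringHom_apply, map_mul, map_pow, map_prod]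
    simp only [map_pow, coeToPowerSeries.ringHom_apply, Polynomial.coe_X]
  refine ⟨Q.natDegree, ?_⟩
  rw [hcoe, Polynomial.coeff_coe, hmonic.coeff_natDegree]
  exact isUnit_one

/-- **«If (Gr) holds, then Conjecture A of [CS] holds as well»** (Lei–Sujatha 2021, §1), kernel-checked:
granted the leaf `GreenbergFineSelmerProblem` (`h`, OPEN), for elliptic `W/ℚ`, odd `p`, the cyclotomic
`κ` with topological generator `γ`, printed exponents `e` with a stationarity level `N` (displayed),
and a dual datum `D` of `Sel₀(E/ℚ_cyc)` that is finitely generated and torsion over `Λ` (Kato;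
displayed): `μ(D.X) = 0` — Coates–Sujatha's Conjecture A for `(E, p)` in its `μ = 0` form.
[cite: LeiSujatha2021, §1 (the sentence after (Gr))] [cite: GreenbergVatsal2000, p. 2, (1)–(2)] -/
theorem muInvariant_eq_zero_of_greenbergFineSelmerProblem (h : GreenbergFineSelmerProblem)
    (W : WeierstrassCurve ℚ) [W.IsElliptic] (p : ℕ) [Fact p.Prime] (hp : p ≠ 2)
    (κ : ZpExtension ℚ p) (γ : Field.absoluteGaloisGroup ℚ) (hκ : κ.IsCyclotomic)
    (hγ : κ.IsTopGenerator γ) (e : ℕ → ℕ) (he₀ : e 0 = W.mordellWeilRank)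
    (he₁ : e 1 * (p - 1) = (W.baseChange (κ.layer 1)).mordellWeilRank - W.mordellWeilRank)
    (he : ∀ n : ℕ, 2 ≤ n → e n * (p ^ (n - 1) * (p - 1)) =
      (W.baseChange (κ.layer n)).mordellWeilRank - (W.baseChange (κ.layer (n - 1))).mordellWeilRank)
    (N : ℕ) (hN : ∀ n : ℕ, N < n → e n = 0)
    (D : W.FineSelmerDualData κ γ) [Module.Finite (IwasawaAlgebra p) D.X]
    (hX : Module.IsTorsion (IwasawaAlgebra p) D.X) :
    muInvariant p D.X = 0 := by
  have hchar := h W p hp κ γ hκ hγ e he₀ he₁ he N hN D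
  obtain ⟨m, hm⟩ := exists_isUnit_coeff_grProduct p (e 0 - 1) (fun n ↦ e n - 1) N
  exact (muInvariant_eq_zero_iff_exists_isUnit_coeff_of_charIdeal_eq_span D.X hX hchar).mpr ⟨m, hm⟩

end Summit.BirchSwinnertonDyer.Rank1Residual.FineSelmer

end
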